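/-
Copyright (c) 2026 the pub-hodgecm-mathlib formalisation cell (harness21).  Prover seat hodgecm-mathlib-LH4-p10 (g6): Track A «(D-RAM) FOUR-FRAME» squad of crux H413, STAGE-1b,
dealer LH4-plan (g13) WORD #64 (2) «(NV) THE H-SIDE COUNT IN THE CONE TOKENS» (SCOPE (T5-P-cone) v1 f7dbd856 §3, LH4-p07 (g9); SCOPE-NV v1 6820f7f1, this seat).  2026-09-04.
-/
import Summits.HodgeConjecture.HodgeConjecture.Theorems.F0P3cDyRamFrameRamKAtPlace                  -- ★ p858003 (LH4-p12 (g5)): `ramK_frame_at_place'` (Θ residually trivial, the Θ-datum on `M`, `|ι a| = |a|`); brings ★ (S2′-E) dictionary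
import Summits.HodgeConjecture.HodgeConjecture.Theorems.F0P3cDyRamTypeBSelector                      -- ★ p858321 (LH4-p05 (g5)): `not_inertDatum_typeB_of_organ`, `discDepth_eq_typeB_of_organ`
import Summits.HodgeConjecture.HodgeConjecture.Theorems.F0P3cDyRamTypeASelector                      -- ★ p858170 (LH4-p11 (g5)): `not_eisensteinDatum_typeA`
import Summits.HodgeConjecture.HodgeConjecture.Theorems.F0P3cDyRamHSideClosedForm                     -- ★ p857701 (LH4-p09 (g5)): `hSide_closedForm_of_tube_exists`
import Summits.HodgeConjecture.HodgeConjecture.Theorems.F0P3cDyRamTypeTwoLevelDictionary                -- ★ p858041 (LH4-p11 (g5)): `sq_sub_map_eq_map_disc`, `condLevel_eq_of_hlev`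
import Literature.NumberTheory.Automorphic.ProjectiveDescentLatticeLevelsDischarge                   -- ★ `valued_toPlace_eq_pow_two_of_ramified`
import Literature.NumberTheory.Automorphic.RamifiedPlaceResidueApproximation                        -- ★ `exists_valued_sub_toPlace_lt_one_of_ne_one`
import Literature.NumberTheory.Automorphic.AdicCompletionCompact                                     -- ★ `finite_residueField_adicCompletion`
import HarnessLib

/-!
# F0 · P3c · line LH4 «(D-RAM) FOUR-FRAME» — STAGE-1b, (NV): THE H-SIDE COUNT `N_V = #Fix_{γ₂}(U₂ ⧸ K₂) + d % 2` IN CLOSED FORM AT THE CONDUCTOR TOKEN `jl`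
# OF THE LINE MODEL — types RamK and U as ONE-CALL lemmas (type RamM is ★ `hSide_closedForm_ramM_hLevel`, LH4-p09 (g6))

Cell `pub/hodgecm-mathlib` (D-0151), crux H413 = `stmt-HodgeConjecture-24833` (helper lane `--supports stmt-HodgeConjecture-24833 --as helper`, count-neutral); THEOREMS ONLY
(no definition, no instance, no notation, no named fact, no `sorry`, default heartbeats); ★ imports only.

WHY.  In ★ p859606 `gSide_levels_typeTwo_X_of_censusLaw` (LH4-p04 (g7)) the row-(2) hypothesis (hG₂) of the three STAGE-1b H-side stubs `stub_hside_levLo ∕ levHi ∕ sq` is ONE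
census law `hLaw : (β,θ)_v·q_v^{−m}·νG₃(K)·(cnt_{a′,b′}(ι_w t_h) − cnt_{a′,b′}(ι_w t_a)) = cA∕2·(#Fix_{γ₂}(U₂∕K₂) + d % 2) + cB∕2`, whose right-hand number
`N_V := #Fix_{γ₂}(U₂ ⧸ K₂) + d % 2` is PIECE-INDEPENDENT: it reads `γ_H = (γ₂, γ₁)` only through the third-field TYPE of the line model `M = E′_{w₁}` and the CONDUCTOR TOKEN
`jl` (`|lam − ρ lam|_M = exp(−jl)` for the eigenvalue `lam` of `ι_w(γ₂)` in `M`).  The cone tokens `(m, m_s, jl_s, n, nν)` of LH4-p07 (g9)'s SCOPE (T5-P-cone) enter the G-side only.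
Its closed form is ★ p857701 `hSide_closedForm_of_tube_exists` (LH4-p09 (g5): torus datum of the descent, INERT ∕ EISENSTEIN disjunction with `d_K`, depth `n`, level identity) read
through the type's ★ SELECTOR organ and the ★ level link `jl = 2n + d_K` (p858041); for type RamM this reading is ★ `hSide_closedForm_ramM_hLevel` (p858207, LH4-p09 (g6); cited by
★ `orderCountCensusC` in one line), for types RamK and U it existed only INLINED in ★ `orderCountCensusB` (B-5) ∕ ★ `orderCountCensusA` (the unit-0 road).  This file makes the two
inlined blocks ONE-CALL lemmas in the same binder currency, so the (LAW) assembly of the level pieces (LH4-p07 (g9)'s END `levels_typeTwo_censusLaw_{lo,hi,sq}_ofRecord`, per type)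
quotes the H-side number by name:
* `hSide_closedForm_ramK_hLevel` — TYPE RamK (`|α − ρα| = 1`, `|α − Θα| < 1`): `jl = 2n + d` and **`(q_w − 1)·(#Fix_{γ₂}(U₂ ⧸ K₂) + d % 2) + 2 = 2·q_w^{(jl − d)∕2 + 1}`**
  (★ `ramK_frame_at_place'` ⇒ Θ residually trivial + the Θ-datum of depth `d` on `M` + `|ι a| = |a|`; ★ p857701; INERT branch killed by ★ `not_inertDatum_typeB_of_organ`;
  `d_K = d` by ★ `discDepth_eq_typeB_of_organ`; `jl = 2n + d_K` by ★ `condLevel_eq_of_hlev`) — the (B-5) block of ★ `orderCountCensusB` (LH4-p07 (g7)) as a lemma;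
* `hSide_closedForm_unr_hLevel` — TYPE U (`|α − ρα| = 1`, `|ρα − Θα| < 1`): `jl = 2n` and **`(q_w − 1)·(#Fix_{γ₂}(U₂ ⧸ K₂) + d % 2) + 2 = (q_w + 1)·q_w^{jl∕2}`**
  (EISENSTEIN branch killed by ★ `not_eisensteinDatum_typeA`, so `d_K = 0`) — the H-side block of ★ `orderCountCensusA` (LH4-p11 (g5)) as a lemma, with `jl` READ from the token.
Inputs (both): the place datum, `γ₂` with NO `w`-root (`hirr'`, the quadratic form of the :418 letter), the TUBE `|tr² − 4det|_w < |4|_w|ϖ|_w²|tr|_w²` and the trace token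
`|tr|_w = |2|_w` (near `1` both hold: ★ `eventually_nhds_one_valued_trace_sub_two_le` + ★ `valued_trace_eq_of_sub_two_lt`, or ★ `F0P3cDyRamTypeTwoTubeLetters`), the line-model
letters of the ★ sockets (A)∕(B) and the eigen-package `lam² = ι(tr)·lam − ι(det)`, `ρ lam = ι(tr) − lam`, `Θ lam·lam = 1`, `det·σ det = 1`, and the conductor token `hjl`.
WHAT IS NOT CLAIMED: no census, no law; `N_V`'s closed form is ★ since p857701 — this file only re-keys it to the token `jl` per type.  HONEST LABEL: HC_CM is proved only modulo the 7
printed citations (2 remaining named inputs: hLiu418 = stmt-HodgeConjecture-24832, h413 = stmt-HodgeConjecture-24833) until rung 0 closes; count-neutral.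

## References
* [Kottwitz1988] R. E. Kottwitz, *Tamagawa numbers*, Ann. of Math. 127 (1988), §2 (orbital integrals of indicators as fixed-coset counts).
* [LabesseLanglands1979] J.-P. Labesse, R. P. Langlands, *L-indistinguishability for SL(2)*, Canad. J. Math. 31 (1979), §2 pp. 7–8 (quadratic tori, conductor, fixed balls).
* [Rogawski1990] J. D. Rogawski, *Automorphic Representations of Unitary Groups in Three Variables*, Ann. of Math. Stud. 123 (1990), §4.9 Prop. 4.9.1 (b) p. 55, Lemma 4.9.3 p. 56.
-/

set_option autoImplicit false

noncomputable section

namespace Summit.HodgeConjecture.HodgeConjecture.Cruxes.H413.F0P3cDyRamHSideClosedFormConeTokens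

open MeasureTheory Measure NumberField IsDedekindDomain Topology Filter
open Literature.NumberTheory.Automorphic Literature.NumberTheory.Automorphic.UnitaryGroup Literature.NumberTheory.Automorphic.IntegralReduction
open Literature.NumberTheory.Rogawski1990 Literature.NumberTheory.GaloisRepresentations
open Literature.NumberTheory.Automorphic.UnitaryThreeFourFrame
open scoped Matrix MatrixGroups Classical Valued WithZero
open Summit.HodgeConjecture.HodgeConjecture.Cruxes.H413.F0P3cDyRamFrameRamKAtPlace (ramK_frame_at_place')
open Summit.HodgeConjecture.HodgeConjecture.Cruxes.H413.F0P3cDyRamHSideClosedForm (hSide_closedForm_of_tube_exists)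
open Summit.HodgeConjecture.HodgeConjecture.Cruxes.H413.F0P3cDyRamTypeTwoLevelDictionary (sq_sub_map_eq_map_disc condLevel_eq_of_hlev)

section Tube

variable {E M : Type*} [Field E] [Field M] [Valued E ℤᵐ⁰] [Valued M ℤᵐ⁰]

/-- **§0 THE TUBE FROM THE CONDUCTOR TOKEN** (the 10-line block ★ `orderCountCensusB` (B-5) repeats, as a lemma; ISOMETRIC line models — types U and RamK).  For an isometric
`jE : E →+* M`, an eigen-package `ρ lam = jE t − lam`, `lam² = jE t·lam − jE D`, a uniformiser `ϖ` of `E` with `|2| = |ϖ|^{tE}`, the trace token `|t| = |2|` and the conductor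
token `|lam − ρ lam| = |jE ϖ|^{jl}·|α − ρ α|` with `|α − ρ α| = 1` (★ p859713's `hjl` spelling): if `2·tE + 2 ≤ jl` (the element is deep enough — near `1` every token is large, ★ `eventually_nhds_one_le_tokenDepth`), then `t, D` lie in the TUBE
`|t² − 4D| < |4|·|ϖ|²·|t|²` of ★ `hSide_closedForm_of_tube_exists` (`|t² − 4D| = exp(−2jl)` by ★ `sq_sub_map_eq_map_disc`, `|4|·|ϖ|²·|t|² = exp(−(4tE + 2))`).
[cite: LabesseLanglands1979, §2 pp. 7–8] [cite: Rogawski1990, §4.9 Lemma 4.9.3 p. 56] -/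
theorem tube_of_conductor_le (jE : E →+* M) (hiso : ∀ x, Valued.v (jE x) = Valued.v x)
    {ρ : M →+* M} {lam : M} {t D : E} (hρlam : ρ lam = jE t - lam) (hlam2 : lam * lam = jE t * lam - jE D)
    {ϖ : E} (hϖ : Valued.v ϖ = WithZero.exp (-1 : ℤ)) {tE : ℕ} (h2 : Valued.v (2 : E) = Valued.v ϖ ^ tE)
    (htr : Valued.v t = Valued.v (2 : E)) {α : M} (hα : Valued.v (α - ρ α) = 1)
    {jl : ℕ} (hjl : Valued.v (lam - ρ lam) = Valued.v (jE ϖ) ^ jl * Valued.v (α - ρ α)) (hle : 2 * tE + 2 ≤ jl) :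
    Valued.v (t ^ 2 - 4 * D) < Valued.v (4 : E) * Valued.v ϖ ^ 2 * Valued.v t ^ 2 := by
  have hsq := sq_sub_map_eq_map_disc jE hρlam hlam2
  have hjlv : Valued.v (lam - ρ lam) = WithZero.exp (-(jl : ℤ)) := by
    rw [hjl, hα, mul_one, hiso, hϖ, ← WithZero.exp_nsmul, nsmul_eq_mul, mul_neg, mul_one]
  have hΔ : Valued.v (t ^ 2 - 4 * D) = WithZero.exp (-(2 * (jl : ℤ))) := by
    rw [← hiso, ← hsq, map_pow, hjlv, ← WithZero.exp_nsmul, nsmul_eq_mul]; congr 1; ring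
  rw [hΔ, htr, show (4 : E) = 2 ^ 2 by norm_num, map_pow, h2, hϖ, ← pow_mul, ← pow_add, ← pow_add, ← WithZero.exp_nsmul, nsmul_eq_mul, mul_neg, mul_one,
    WithZero.exp_lt_exp]
  push_cast; omega

end Tube

section Place

variable (L : Type) [Field L] [NumberField L] [IsCMField L] (v : HeightOneSpectrum (𝓞 ↥(maximalRealSubfield L)))
  (w : UnitaryGroup.PlacesOver L v) (hw : IsCMField.complexConj L • w.1 = w.1)
  [Fintype (Valued.ResidueField (w.1.adicCompletion L))]

include hw in
/-- **(NV-RK) THE H-SIDE COUNT AT THE CONDUCTOR TOKEN, TYPE RamK** — the (B-5) block of ★ `orderCountCensusB` (LH4-p07 (g7)) as ONE lemma.  At a ramified non-split CM place `w ∣ v`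
(`he`, datum `hD`), let `γ₂ ∈ U₂(L⁺_v)` have NO eigenvalue in `L_w` (`hirr'`), lie in the TUBE (`htube`) with trace token `|tr|_w = |2|_w` (`htr`), and carry a type-RamK line model
`M = E′_{w₁}` (socket (B) letters: `ρ = c₁` an isometric involution fixing exactly `ι(L_w)`, `Θ` the transported conjugation, `|α − ρα| = 1`, `|α − Θα| < 1`) with eigen-package
`(lam; hlam2, hρlam, hΘlam)`, `det·σ det = 1`, and conductor token `|lam − ρ lam| = exp(−jl)`.  THEN `d ≤ jl`, `jl ≡ d (2)` and
`(q_w − 1)·(#Fix_{γ₂}(U₂ ⧸ K₂) + d % 2) + 2 = 2·q_w^{(jl − d)∕2 + 1}` — i.e. `N_V = 2·[n_H + 1]_{q_w}` with `2·n_H = jl − d`.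
★ `ramK_frame_at_place'` ∘ ★ `hSide_closedForm_of_tube_exists` ∘ ★ `not_inertDatum_typeB_of_organ` ∘ ★ `discDepth_eq_typeB_of_organ` ∘ ★ `condLevel_eq_of_hlev`.
[cite: Kottwitz1988, §2] [cite: LabesseLanglands1979, §2 pp. 7–8] [cite: Rogawski1990, §4.9 Prop. 4.9.1 (b) p. 55, Lemma 4.9.3 p. 56] -/
theorem hSide_closedForm_ramK_hLevel (he : v.asIdeal.ramificationIdx' w.1.asIdeal ≠ 1)
    {ϖ : w.1.adicCompletion L} {d tE : ℕ} (hD : IsRamifiedQuadraticDatum (galAdicCompletionMap (L := L) (IsCMField.complexConj L) hw) ϖ d tE)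
    (γ₂ : ((cmDatum L 2 (Matrix.of fun i j : Fin 2 => if i.val + j.val + 1 = 2 then (1 : L) else 0)).Local v))
    (hirr' : ∀ x : (w.1.adicCompletion L), x * x - (((γ₂.val : GL (Fin 2) (UnitaryGroup.LocalRing L v)).val.map (Pi.evalRingHom (fun w' : UnitaryGroup.PlacesOver L v => w'.1.adicCompletion L) w))).trace * x +
      (((γ₂.val : GL (Fin 2) (UnitaryGroup.LocalRing L v)).val.map (Pi.evalRingHom (fun w' : UnitaryGroup.PlacesOver L v => w'.1.adicCompletion L) w))).det ≠ 0)
    (htube : Valued.v ((((γ₂.val : GL (Fin 2) (UnitaryGroup.LocalRing L v)).val.map (Pi.evalRingHom (fun w' : UnitaryGroup.PlacesOver L v => w'.1.adicCompletion L) w))).trace ^ 2 -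
        4 * (((γ₂.val : GL (Fin 2) (UnitaryGroup.LocalRing L v)).val.map (Pi.evalRingHom (fun w' : UnitaryGroup.PlacesOver L v => w'.1.adicCompletion L) w))).det) <
      Valued.v (4 : w.1.adicCompletion L) * Valued.v ϖ ^ 2 *
        Valued.v ((((γ₂.val : GL (Fin 2) (UnitaryGroup.LocalRing L v)).val.map (Pi.evalRingHom (fun w' : UnitaryGroup.PlacesOver L v => w'.1.adicCompletion L) w))).trace) ^ 2)
    (htr : Valued.v ((((γ₂.val : GL (Fin 2) (UnitaryGroup.LocalRing L v)).val.map (Pi.evalRingHom (fun w' : UnitaryGroup.PlacesOver L v => w'.1.adicCompletion L) w))).trace) =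
      Valued.v (2 : w.1.adicCompletion L))
    -- the line model `M = E′_{w₁}` (socket (B) letters)
    (E' : Type) [Field E'] [NumberField E'] [Algebra L E'] [Algebra.IsQuadraticExtension L E'] (c₁ : E' ≃ₐ[L] E') (hc₁ : c₁ ≠ 1)
    (w₁ : UnitaryGroup.PlacesOver E' w.1) (hw₁ : c₁ • w₁.1 = w₁.1)
    (Θ : (w₁.1.adicCompletion E') →+* (w₁.1.adicCompletion E')) {α lam : w₁.1.adicCompletion E'}
    (hρρ : ∀ z, galAdicCompletionMap (L := E') c₁ hw₁ (galAdicCompletionMap (L := E') c₁ hw₁ z) = z)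
    (hvρ : ∀ z, Valued.v (galAdicCompletionMap (L := E') c₁ hw₁ z) = Valued.v z)
    (hjle1 : ∀ a, Valued.v (toPlace w.1 w₁ a) ≤ 1 ↔ Valued.v a ≤ 1)
    (hjfix : ∀ z : (w₁.1.adicCompletion E'), galAdicCompletionMap (L := E') c₁ hw₁ z = z ↔ ∃ a, toPlace w.1 w₁ a = z)
    (hΘj : ∀ a, Θ (toPlace w.1 w₁ a) = toPlace w.1 w₁ ((galAdicCompletionMap (L := L) (IsCMField.complexConj L) hw) a))
    (hΘΘ : ∀ z, Θ (Θ z) = z) (hΘρ : ∀ z, Θ (galAdicCompletionMap (L := E') c₁ hw₁ z) = galAdicCompletionMap (L := E') c₁ hw₁ (Θ z)) (hvΘ : ∀ z, Valued.v (Θ z) = Valued.v z)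
    (hα1 : Valued.v α ≤ 1) (hα : Valued.v (α - galAdicCompletionMap (L := E') c₁ hw₁ α) = 1) (hram : Valued.v (α - Θ α) < 1)
    -- the eigen-package of `γ₂` in `M` and the unitarity letter of its block
    (hlam2 : lam * lam = toPlace w.1 w₁ ((((γ₂.val : GL (Fin 2) (UnitaryGroup.LocalRing L v)).val.map (Pi.evalRingHom (fun w' : UnitaryGroup.PlacesOver L v => w'.1.adicCompletion L) w))).trace) * lam -
      toPlace w.1 w₁ ((((γ₂.val : GL (Fin 2) (UnitaryGroup.LocalRing L v)).val.map (Pi.evalRingHom (fun w' : UnitaryGroup.PlacesOver L v => w'.1.adicCompletion L) w))).det))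
    (hρlam : galAdicCompletionMap (L := E') c₁ hw₁ lam = toPlace w.1 w₁ ((((γ₂.val : GL (Fin 2) (UnitaryGroup.LocalRing L v)).val.map (Pi.evalRingHom (fun w' : UnitaryGroup.PlacesOver L v => w'.1.adicCompletion L) w))).trace) - lam)
    (hΘlam : Θ lam * lam = 1)
    (hDσ : (((γ₂.val : GL (Fin 2) (UnitaryGroup.LocalRing L v)).val.map (Pi.evalRingHom (fun w' : UnitaryGroup.PlacesOver L v => w'.1.adicCompletion L) w))).det *
      (galAdicCompletionMap (L := L) (IsCMField.complexConj L) hw) (((γ₂.val : GL (Fin 2) (UnitaryGroup.LocalRing L v)).val.map (Pi.evalRingHom (fun w' : UnitaryGroup.PlacesOver L v => w'.1.adicCompletion L) w))).det = 1)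
    -- the conductor token, in the cone's spelling (★ p859713 `hjl`)
    {jl : ℕ} (hjl : Valued.v (lam - galAdicCompletionMap (L := E') c₁ hw₁ lam) = Valued.v (toPlace w.1 w₁ ϖ) ^ jl * Valued.v (α - galAdicCompletionMap (L := E') c₁ hw₁ α)) :
    d ≤ jl ∧ (jl - d) % 2 = 0 ∧
      (Fintype.card (Valued.ResidueField (w.1.adicCompletion L)) - 1) *
          (Nat.card (MulAction.fixedBy (((cmDatum L 2 (Matrix.of fun i j : Fin 2 => if i.val + j.val + 1 = 2 then (1 : L) else 0)).Local v) ⧸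
                cmLocalIntegralLevel L 2 (Matrix.of fun i j : Fin 2 => if i.val + j.val + 1 = 2 then (1 : L) else 0) v) γ₂) + d % 2) + 2 =
        2 * Fintype.card (Valued.ResidueField (w.1.adicCompletion L)) ^ ((jl - d) / 2 + 1) := by
  have hc1 : IsCMField.complexConj L ≠ 1 := IsCMField.complexConj_ne_one L
  have hϖ : Valued.v ϖ = WithZero.exp (-1 : ℤ) := hD.2.2.1
  have h20 : (2 : w.1.adicCompletion L) ≠ 0 := two_ne_zero
  -- abbreviations: `ρ' = c₁` on `M`, `ιw = ι_{w₁}`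
  set ρ' : (w₁.1.adicCompletion E') →+* (w₁.1.adicCompletion E') := galAdicCompletionMap (L := E') c₁ hw₁ with hρ'def
  set ιw : (w.1.adicCompletion L) →+* (w₁.1.adicCompletion E') := toPlace w.1 w₁ with hιwdef
  -- (B-0) the one-field RamK frame at the place (★ `ramK_frame_at_place'`): Θ residually trivial, the Θ-datum on `M`, `|ι a| = |a|`
  haveI : Finite 𝓀[w₁.1.adicCompletion E'] := finite_residueField_adicCompletion E' w₁.1
  obtain ⟨-, hΘres, -, hDΘ, hjv1, -⟩ :=
    ramK_frame_at_place' L w hw E' c₁ w₁ hw₁ hc₁ he hD Θ hρρ hvρ hjle1 hjfix hΘj hΘΘ hvΘ hα1 hα hram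
  -- the conductor token in `exp` form: `|lam − ρ lam| = exp(−jl)`
  have hjlv : Valued.v (lam - ρ' lam) = WithZero.exp (-(jl : ℤ)) := by
    rw [hjl, hα, mul_one, hjv1, hϖ, ← WithZero.exp_nsmul, nsmul_eq_mul, mul_neg, mul_one]
  -- the :418 letter in `charpoly` form, from its quadratic form `hirr'`
  have hirr : ¬ ∃ x : (w.1.adicCompletion L), ((((γ₂.val : GL (Fin 2) (UnitaryGroup.LocalRing L v)).val.map
      (Pi.evalRingHom (fun w' : UnitaryGroup.PlacesOver L v => w'.1.adicCompletion L) w))).charpoly).IsRoot x := by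
    rintro ⟨x, hx⟩
    rw [Matrix.charpoly_fin_two, Polynomial.IsRoot.def] at hx
    simp only [Polynomial.eval_add, Polynomial.eval_sub, Polynomial.eval_mul, Polynomial.eval_pow, Polynomial.eval_C, Polynomial.eval_X] at hx
    exact hirr' x (by rw [← hx]; ring)
  have ht0 : (((γ₂.val : GL (Fin 2) (UnitaryGroup.LocalRing L v)).val.map
      (Pi.evalRingHom (fun w' : UnitaryGroup.PlacesOver L v => w'.1.adicCompletion L) w))).trace ≠ 0 := fun h0 => by
    rw [h0, map_zero] at htr; exact h20 ((map_eq_zero _).1 htr.symm)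
  -- `(lam − ρ lam)² = ι(tr² − 4 det)` (★ p858041)
  have hsq := sq_sub_map_eq_map_disc ιw hρlam hlam2
  -- THE H-SIDE ORGAN (★ p857701 `hSide_closedForm_of_tube_exists`), uniformiser of `F_v` = ★ `HeckeCharacter.valued_uniformizer`
  haveI : Finite (IsLocalRing.ResidueField 𝒪[v.adicCompletion ↥(maximalRealSubfield L)]) :=
    finite_residueField_adicCompletion ↥(maximalRealSubfield L) v
  obtain ⟨αH, sH, g, uτ, wτ, z, n, dK, hαH, hvαH, hsH, hdesc, hz, hdisc, huτ, hdat, hdK, hlev⟩ :=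
    hSide_closedForm_of_tube_exists L v w hw (HeckeCharacter.valued_uniformizer (K := ↥(maximalRealSubfield L)) v) he hD γ₂ hirr htube
  -- place letters for the selector organs: `σ ∘ ι_v = ι_v`, `|ι_v y| = |y|²`, `αH ≠ 0`
  have hσι : ∀ y, (galAdicCompletionMap (L := L) (IsCMField.complexConj L) hw) (toPlace v w y) = toPlace v w y :=
    fun y => galAdicCompletionMap_toPlace (IsCMField.complexConj L) w w hw y
  have hι2 : ∀ y, Valued.v (toPlace v w y) = Valued.v y ^ 2 :=
    fun y => valued_toPlace_eq_pow_two_of_ramified (IsCMField.complexConj L) w hc1 hw he y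
  have hαH0 : αH ≠ 0 := fun h0 => by
    rw [h0, map_zero] at hvαH
    rcases hvαH with h1 | h1
    · exact zero_ne_one h1
    · exact WithZero.zero_ne_coe h1
  -- the INERT branch is impossible on type RamK (Θ residually trivial) — ★ (S-sel) `not_inertDatum_typeB_of_organ` (LH4-p05 (g5))
  obtain ⟨-, hwτ1, hH⟩ := hdat.resolve_left (fun hin =>
    F0P3cDyRamTypeBSelector.not_inertDatum_typeB_of_organ (toPlace v w) hι2 _ hσι ιw hjv1 ρ' Θ
      hjfix hΘj hΘres h20 hlam2 hρlam hΘlam hirr' ht0 rfl rfl hαH0 hsH hdesc hz hdisc huτ hin.1 hdK hin.2.2.1)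
  -- the level link `jl = 2n + dK` (★ p858041) and the type-RamK exponent `dK = d` (★ (S-dK) `discDepth_eq_typeB_of_organ`)
  have hjl2n : jl = 2 * n + dK :=
    condLevel_eq_of_hlev ιw hjv1 hϖ hsq hjlv hlev htr ((Valuation.ne_zero_iff _).2 h20)
  have hdKd : dK = d :=
    F0P3cDyRamTypeBSelector.discDepth_eq_typeB_of_organ (toPlace v w) hι2 _ hσι ιw hjv1 ρ' Θ
      hρρ hvρ hjfix hΘj hΘΘ hΘρ h20 hDΘ hlam2 hρlam hΘlam hDσ ht0 rfl rfl hαH0 hsH hdesc (Matrix.GeneralLinearGroup.det_ne_zero g) hz hdisc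
      (HeckeCharacter.valued_uniformizer (K := ↥(maximalRealSubfield L)) v) hwτ1 hdK
  refine ⟨by omega, by omega, ?_⟩
  rw [show (jl - d) / 2 + 1 = n + 1 by omega]
  exact hH

include hw in
/-- **(NV-U) THE H-SIDE COUNT AT THE CONDUCTOR TOKEN, TYPE U** — the H-side block of ★ `orderCountCensusA` (LH4-p11 (g5)) as ONE lemma, with `jl` READ from the token.  Same place,
tube and trace letters as `hSide_closedForm_ramK_hLevel`; the line model is of type U (socket (A) letters: `|α − ρα| = 1`, `|ρα − Θα| < 1` — `τ = Θρ` residually trivial), the place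
is dyadic (`h2v : |2|_w < 1`).  THEN `jl` is EVEN and `(q_w − 1)·(#Fix_{γ₂}(U₂ ⧸ K₂) + d % 2) + 2 = (q_w + 1)·q_w^{jl∕2}` — i.e. `N_V = 1 + (q_w + 1)·[n_H]_{q_w}` with `2·n_H = jl`
(the EISENSTEIN branch of ★ p857701 is killed by ★ `not_eisensteinDatum_typeA`, so `d_K = 0` and ★ `condLevel_eq_of_hlev` reads `jl = 2n`; `|ι a| = |a|` by ★ (S2′-E)
`valued_toPlace_of_v_sub_galAdicCompletionMap_eq_one`).
[cite: Kottwitz1988, §2] [cite: LabesseLanglands1979, §2 pp. 7–8] [cite: Rogawski1990, §4.9 Prop. 4.9.1 (b) p. 55, Lemma 4.9.3 p. 56] -/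
theorem hSide_closedForm_unr_hLevel (he : v.asIdeal.ramificationIdx' w.1.asIdeal ≠ 1)
    {ϖ : w.1.adicCompletion L} {d tE : ℕ} (hD : IsRamifiedQuadraticDatum (galAdicCompletionMap (L := L) (IsCMField.complexConj L) hw) ϖ d tE)
    (h2v : Valued.v (2 : w.1.adicCompletion L) < 1)
    (γ₂ : ((cmDatum L 2 (Matrix.of fun i j : Fin 2 => if i.val + j.val + 1 = 2 then (1 : L) else 0)).Local v))
    (hirr' : ∀ x : (w.1.adicCompletion L), x * x - (((γ₂.val : GL (Fin 2) (UnitaryGroup.LocalRing L v)).val.map (Pi.evalRingHom (fun w' : UnitaryGroup.PlacesOver L v => w'.1.adicCompletion L) w))).trace * x +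
      (((γ₂.val : GL (Fin 2) (UnitaryGroup.LocalRing L v)).val.map (Pi.evalRingHom (fun w' : UnitaryGroup.PlacesOver L v => w'.1.adicCompletion L) w))).det ≠ 0)
    (htube : Valued.v ((((γ₂.val : GL (Fin 2) (UnitaryGroup.LocalRing L v)).val.map (Pi.evalRingHom (fun w' : UnitaryGroup.PlacesOver L v => w'.1.adicCompletion L) w))).trace ^ 2 -
        4 * (((γ₂.val : GL (Fin 2) (UnitaryGroup.LocalRing L v)).val.map (Pi.evalRingHom (fun w' : UnitaryGroup.PlacesOver L v => w'.1.adicCompletion L) w))).det) <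
      Valued.v (4 : w.1.adicCompletion L) * Valued.v ϖ ^ 2 *
        Valued.v ((((γ₂.val : GL (Fin 2) (UnitaryGroup.LocalRing L v)).val.map (Pi.evalRingHom (fun w' : UnitaryGroup.PlacesOver L v => w'.1.adicCompletion L) w))).trace) ^ 2)
    (htr : Valued.v ((((γ₂.val : GL (Fin 2) (UnitaryGroup.LocalRing L v)).val.map (Pi.evalRingHom (fun w' : UnitaryGroup.PlacesOver L v => w'.1.adicCompletion L) w))).trace) =
      Valued.v (2 : w.1.adicCompletion L))
    -- the line model `M = E′_{w₁}` (socket (A) letters)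
    (E' : Type) [Field E'] [NumberField E'] [Algebra L E'] [Algebra.IsQuadraticExtension L E'] (c₁ : E' ≃ₐ[L] E') (hc₁ : c₁ ≠ 1)
    (w₁ : UnitaryGroup.PlacesOver E' w.1) (hw₁ : c₁ • w₁.1 = w₁.1)
    (Θ : (w₁.1.adicCompletion E') →+* (w₁.1.adicCompletion E')) {α lam : w₁.1.adicCompletion E'}
    (hρρ : ∀ z, galAdicCompletionMap (L := E') c₁ hw₁ (galAdicCompletionMap (L := E') c₁ hw₁ z) = z)
    (hvρ : ∀ z, Valued.v (galAdicCompletionMap (L := E') c₁ hw₁ z) = Valued.v z)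
    (hjfix : ∀ z : (w₁.1.adicCompletion E'), galAdicCompletionMap (L := E') c₁ hw₁ z = z ↔ ∃ a, toPlace w.1 w₁ a = z)
    (hΘj : ∀ a, Θ (toPlace w.1 w₁ a) = toPlace w.1 w₁ ((galAdicCompletionMap (L := L) (IsCMField.complexConj L) hw) a))
    (hΘΘ : ∀ z, Θ (Θ z) = z) (hΘρ : ∀ z, Θ (galAdicCompletionMap (L := E') c₁ hw₁ z) = galAdicCompletionMap (L := E') c₁ hw₁ (Θ z)) (hvΘ : ∀ z, Valued.v (Θ z) = Valued.v z)
    (hα1 : Valued.v α ≤ 1) (hα : Valued.v (α - galAdicCompletionMap (L := E') c₁ hw₁ α) = 1) (hτα : Valued.v (galAdicCompletionMap (L := E') c₁ hw₁ α - Θ α) < 1)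
    -- the eigen-package of `γ₂` in `M` and the unitarity letter of its block
    (hlam2 : lam * lam = toPlace w.1 w₁ ((((γ₂.val : GL (Fin 2) (UnitaryGroup.LocalRing L v)).val.map (Pi.evalRingHom (fun w' : UnitaryGroup.PlacesOver L v => w'.1.adicCompletion L) w))).trace) * lam -
      toPlace w.1 w₁ ((((γ₂.val : GL (Fin 2) (UnitaryGroup.LocalRing L v)).val.map (Pi.evalRingHom (fun w' : UnitaryGroup.PlacesOver L v => w'.1.adicCompletion L) w))).det))
    (hρlam : galAdicCompletionMap (L := E') c₁ hw₁ lam = toPlace w.1 w₁ ((((γ₂.val : GL (Fin 2) (UnitaryGroup.LocalRing L v)).val.map (Pi.evalRingHom (fun w' : UnitaryGroup.PlacesOver L v => w'.1.adicCompletion L) w))).trace) - lam)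
    (hΘlam : Θ lam * lam = 1)
    (hDσ : (((γ₂.val : GL (Fin 2) (UnitaryGroup.LocalRing L v)).val.map (Pi.evalRingHom (fun w' : UnitaryGroup.PlacesOver L v => w'.1.adicCompletion L) w))).det *
      (galAdicCompletionMap (L := L) (IsCMField.complexConj L) hw) (((γ₂.val : GL (Fin 2) (UnitaryGroup.LocalRing L v)).val.map (Pi.evalRingHom (fun w' : UnitaryGroup.PlacesOver L v => w'.1.adicCompletion L) w))).det = 1)
    -- the conductor token, in the cone's spelling (★ p859713 `hjl`)
    {jl : ℕ} (hjl : Valued.v (lam - galAdicCompletionMap (L := E') c₁ hw₁ lam) = Valued.v (toPlace w.1 w₁ ϖ) ^ jl * Valued.v (α - galAdicCompletionMap (L := E') c₁ hw₁ α)) :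
    jl % 2 = 0 ∧
      (Fintype.card (Valued.ResidueField (w.1.adicCompletion L)) - 1) *
          (Nat.card (MulAction.fixedBy (((cmDatum L 2 (Matrix.of fun i j : Fin 2 => if i.val + j.val + 1 = 2 then (1 : L) else 0)).Local v) ⧸
                cmLocalIntegralLevel L 2 (Matrix.of fun i j : Fin 2 => if i.val + j.val + 1 = 2 then (1 : L) else 0) v) γ₂) + d % 2) + 2 =
        (Fintype.card (Valued.ResidueField (w.1.adicCompletion L)) + 1) * Fintype.card (Valued.ResidueField (w.1.adicCompletion L)) ^ (jl / 2) := by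
  have hc1 : IsCMField.complexConj L ≠ 1 := IsCMField.complexConj_ne_one L
  have hϖ : Valued.v ϖ = WithZero.exp (-1 : ℤ) := hD.2.2.1
  have h20 : (2 : w.1.adicCompletion L) ≠ 0 := two_ne_zero
  -- abbreviations: `ρ' = c₁` on `M`, `ιw = ι_{w₁}`
  set ρ' : (w₁.1.adicCompletion E') →+* (w₁.1.adicCompletion E') := galAdicCompletionMap (L := E') c₁ hw₁ with hρ'def
  set ιw : (w.1.adicCompletion L) →+* (w₁.1.adicCompletion E') := toPlace w.1 w₁ with hιwdef
  -- the type-U isometry `|ι a| = |a|` (★ (S2′-E) dictionary, LH4-p10 (g3))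
  have hjv1 : ∀ a, Valued.v (ιw a) = Valued.v a := fun a =>
    F0P3cDyRamUnramifiedQuadraticCompletionDictionary.valued_toPlace_of_v_sub_galAdicCompletionMap_eq_one E' c₁ w.1 hc₁ w₁ hw₁ hα1 hα a
  -- the conductor token in `exp` form: `|lam − ρ lam| = exp(−jl)`
  have hjlv : Valued.v (lam - ρ' lam) = WithZero.exp (-(jl : ℤ)) := by
    rw [hjl, hα, mul_one, hjv1, hϖ, ← WithZero.exp_nsmul, nsmul_eq_mul, mul_neg, mul_one]
  -- the :418 letter in `charpoly` form, from its quadratic form `hirr'`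
  have hirr : ¬ ∃ x : (w.1.adicCompletion L), ((((γ₂.val : GL (Fin 2) (UnitaryGroup.LocalRing L v)).val.map
      (Pi.evalRingHom (fun w' : UnitaryGroup.PlacesOver L v => w'.1.adicCompletion L) w))).charpoly).IsRoot x := by
    rintro ⟨x, hx⟩
    rw [Matrix.charpoly_fin_two, Polynomial.IsRoot.def] at hx
    simp only [Polynomial.eval_add, Polynomial.eval_sub, Polynomial.eval_mul, Polynomial.eval_pow, Polynomial.eval_C, Polynomial.eval_X] at hx
    exact hirr' x (by rw [← hx]; ring)
  have ht0 : (((γ₂.val : GL (Fin 2) (UnitaryGroup.LocalRing L v)).val.map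
      (Pi.evalRingHom (fun w' : UnitaryGroup.PlacesOver L v => w'.1.adicCompletion L) w))).trace ≠ 0 := fun h0 => by
    rw [h0, map_zero] at htr; exact h20 ((map_eq_zero _).1 htr.symm)
  -- `(lam − ρ lam)² = ι(tr² − 4 det)` (★ p858041)
  have hsq := sq_sub_map_eq_map_disc ιw hρlam hlam2
  -- THE H-SIDE ORGAN (★ p857701 `hSide_closedForm_of_tube_exists`)
  haveI : Finite (IsLocalRing.ResidueField 𝒪[v.adicCompletion ↥(maximalRealSubfield L)]) :=
    finite_residueField_adicCompletion ↥(maximalRealSubfield L) v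
  obtain ⟨αH, sH, g, uτ, wτ, z, n, dK, hαH, hvαH, hsH, hdesc, hz, hdisc, huτ, hdat, hdK, hlev⟩ :=
    hSide_closedForm_of_tube_exists L v w hw (HeckeCharacter.valued_uniformizer (K := ↥(maximalRealSubfield L)) v) he hD γ₂ hirr htube
  -- place letters for the selector organ: `σ ∘ ι_v = ι_v`, `|ι_v y| = |y|²`, residue approximation, `σ ϖ ≠ ϖ`, `αH ≠ 0`, `|2|_M < 1`
  have hσι : ∀ y, (galAdicCompletionMap (L := L) (IsCMField.complexConj L) hw) (toPlace v w y) = toPlace v w y :=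
    fun y => galAdicCompletionMap_toPlace (IsCMField.complexConj L) w w hw y
  have hι2 : ∀ y, Valued.v (toPlace v w y) = Valued.v y ^ 2 :=
    fun y => valued_toPlace_eq_pow_two_of_ramified (IsCMField.complexConj L) w hc1 hw he y
  have hresE : ∀ x : w.1.adicCompletion L, Valued.v x ≤ 1 →
      ∃ y : v.adicCompletion ↥(maximalRealSubfield L), Valued.v (toPlace v w y) ≤ 1 ∧ Valued.v (x - toPlace v w y) < 1 := fun x hx => by
    obtain ⟨y, hy1, hy⟩ := exists_valued_sub_toPlace_lt_one_of_ne_one L (IsCMField.complexConj L) v w hc1 hw he x hx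
    exact ⟨y, by rw [hι2]; exact pow_le_one₀ zero_le hy1, hy⟩
  have hσϖ : (galAdicCompletionMap (L := L) (IsCMField.complexConj L) hw) ϖ ≠ ϖ := fun h0 => by
    have h1 := hD.2.2.2.2.1
    rw [h0, sub_self, map_zero] at h1
    exact pow_ne_zero d (by rw [hϖ]; exact WithZero.exp_ne_zero) h1.symm
  have hαH0 : αH ≠ 0 := fun h0 => by
    rw [h0, map_zero] at hvαH
    rcases hvαH with h1 | h1
    · exact zero_ne_one h1
    · exact WithZero.zero_ne_coe h1
  have h2M : Valued.v (2 : w₁.1.adicCompletion E') < 1 := by rw [← map_ofNat ιw 2, hjv1]; exact h2v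
  have h2Mne : (2 : w₁.1.adicCompletion E') ≠ 0 := by rw [← map_ofNat ιw 2]; exact (map_ne_zero _).2 h20
  -- the EISENSTEIN branch is impossible on type U (`τ = Θρ` residually trivial) — ★ `not_eisensteinDatum_typeA` (LH4-p11 (g5))
  obtain ⟨-, -, hdK0, hFix⟩ := hdat.resolve_right fun hE =>
    F0P3cDyRamTypeASelector.not_eisensteinDatum_typeA (toPlace v w) hι2 _ hσι hresE hσϖ ιw hjv1 ρ' Θ hρρ hvρ hjfix hΘj hΘΘ
      hΘρ hvΘ hα1 hα hτα h2M h2Mne hlam2 hρlam hΘlam hDσ ht0 rfl rfl hαH0 hsH hdesc (Matrix.GeneralLinearGroup.det_ne_zero g)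
      (HeckeCharacter.valued_uniformizer (K := ↥(maximalRealSubfield L)) v) hz hdisc hE.1 hE.2.1
  subst hdK0
  -- the level link `jl = 2n + 0` (★ p858041)
  have hjl2n : jl = 2 * n + 0 :=
    condLevel_eq_of_hlev ιw hjv1 hϖ hsq hjlv hlev htr ((Valuation.ne_zero_iff _).2 h20)
  refine ⟨by omega, ?_⟩
  rw [show jl / 2 = n by omega]
  exact hFix

end Place

end Summit.HodgeConjecture.HodgeConjecture.Cruxes.H413.F0P3cDyRamHSideClosedFormConeTokens

end
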